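import Literature.Computability.Complexity.PeresNoiseSensitivity
import Literature.Probability.RandomGraphs.LowDegree
import HarnessLib

/-!
# Crux `MobiusLadder.LiouvilleOrthogonalTC0` (stmt-QuantumAdvantage-1393), line `Sketch`, skeleton v10:
stub `stub_drstRecursion` (P1a) — the Diakonikolas–Raghavendra–Servedio–Tan sensitivity recursion

For an ARBITRARY real function `q` on the cube `{0,1}^m` write `ω^{(i)}` for `ω` with bit `i`
flipped, `piv(q) := Σ_ω #{i : [0 ≤ q ω] ≠ [0 ≤ q ω^{(i)}]}` (the number of pairs (point, pivotal
bit) of the threshold function `[q ≥ 0]`), and `D_j q (ω) := sgn (ω j) · (q ω − q ω^{(j)})` for the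
discrete derivative in direction `j` (a function that does not depend on bit `j`). Then

  `piv(q)² ≤ 2^m · (m · 2^m + Σ_j piv(D_j q))`,

the counting form of the recursion behind the elementary average-sensitivity bound
`AS ≤ 2 m^{1-1/2^d}` for degree-`d` polynomial threshold functions (Diakonikolas–Raghavendra–
Servedio–Tan 2009, arXiv:0909.5011, §6); no degree hypothesis is needed for the recursion itself.

Proof (finite sums over the cube only). Let `F = sgn [q ≥ 0] = ±1`, `X_i ω = sgn (ω i)` and
`G_i = sgn [D_i q ≥ 0] = ±1`. Pointwise, the pivotal indicator is `½ G_i X_i (F − F ∘ flip_i)`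
(`ite_ne_eq_half_mul`, four sign cases); summing and reindexing the second half by the involution
`flip_i` (under which `G_i` is invariant and `X_i` changes sign) gives `piv(q) = Σ_ω F · H` with
`H = Σ_i G_i X_i`. Cauchy–Schwarz gives `piv(q)² ≤ 2^m Σ_ω H²`, and in
`Σ_ω H² = Σ_{i,i'} ⟨G_i X_i, G_{i'} X_{i'}⟩` the diagonal contributes `m 2^m`, while each
off-diagonal term, symmetrised under `flip_i`, is `½ Σ_ω G_i X_i X_{i'} (G_{i'} − G_{i'} ∘ flip_i)`,
at most the number of `ω` with `G_{i'} ω ≠ G_{i'} (flip_i ω)` — a pivotal count of `D_{i'} q`.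

* `StubDrstRecursion.sq_sum_card_pivotal_le` — the abstract statement for a Boolean `f` and a
  family `g_i` (each `g_i` independent of bit `i`) tied to `f` by the pointwise pivotal identity;
* `stub_drstRecursion` — the registered stub (verbatim): `f = [0 ≤ q]`, `g_j = [0 ≤ D_j q]`.
-/

set_option linter.dupNamespace false -- D-0017: single-problem summit ⇒ `QuantumAdvantage.QuantumAdvantage` by design

noncomputable section

namespace Summit.QuantumAdvantage.QuantumAdvantage.Theorems.LiouvilleOrthogonalTC0

open Finset
open Literature.Probability.RandomGraphs.LowDegree (sgn)

namespace StubDrstRecursion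

open Literature.Probability.RandomGraphs.LowDegree (sgn_true sgn_false sgn_mul_self)
open Literature.Computability.Complexity (update_not_update_not)

variable {κ : Type*} [DecidableEq κ]

/-- A product of three signs times a difference of two signs is at most twice the indicator that
the two signs differ: `sgn a · sgn b · sgn c · (sgn u − sgn v) ≤ 2 · [u ≠ v]`. -/
theorem sgn_mul_sub_le (a b c u v : Bool) :
    sgn a * sgn b * sgn c * (sgn u - sgn v) ≤ 2 * (if u ≠ v then 1 else 0 : ℝ) := by
  cases a <;> cases b <;> cases c <;> cases u <;> cases v <;> norm_num [sgn]

/-- **The pointwise pivotal identity.** For reals `a = q ω`, `b = q ω^{(i)}` and the bit `c = ω i`: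
`[[0 ≤ a] ≠ [0 ≤ b]] = ½ · sgn [0 ≤ sgn c · (a − b)] · sgn c · (sgn [0 ≤ a] − sgn [0 ≤ b])`.
Both sides vanish off the pivotal pairs; on a pivotal pair the derivative `sgn c · (a − b)` has the
sign that makes the right-hand side `+1`, in each of the four cases. -/
theorem ite_ne_eq_half_mul (a b : ℝ) (c : Bool) :
    (if decide (0 ≤ a) ≠ decide (0 ≤ b) then (1 : ℝ) else 0) =
      1 / 2 * sgn (decide (0 ≤ sgn c * (a - b))) * sgn c *
        (sgn (decide (0 ≤ a)) - sgn (decide (0 ≤ b))) := by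
  by_cases ha : 0 ≤ a <;> by_cases hb : 0 ≤ b
  · rw [decide_eq_true ha, decide_eq_true hb]
    simp
  · have hb' : b < 0 := not_le.mp hb
    cases c
    · have hd : (0 : ℝ) ≤ sgn false * (a - b) := by rw [sgn_false]; linarith
      rw [decide_eq_true hd, decide_eq_true ha, decide_eq_false hb]
      norm_num
    · have hd : ¬ ((0 : ℝ) ≤ sgn true * (a - b)) := by rw [sgn_true, not_le]; linarith
      rw [decide_eq_false hd, decide_eq_true ha, decide_eq_false hb]
      norm_num
  · have ha' : a < 0 := not_le.mp ha
    cases c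
    · have hd : ¬ ((0 : ℝ) ≤ sgn false * (a - b)) := by rw [sgn_false, not_le]; linarith
      rw [decide_eq_false hd, decide_eq_false ha, decide_eq_true hb]
      norm_num
    · have hd : (0 : ℝ) ≤ sgn true * (a - b) := by rw [sgn_true]; linarith
      rw [decide_eq_true hd, decide_eq_false ha, decide_eq_true hb]
      norm_num
  · rw [decide_eq_false ha, decide_eq_false hb]
    simp

/-- **The discrete derivative `D_i q` does not depend on bit `i`:** its sign bit at `ω^{(i)}`
equals its sign bit at `ω` (because `(ω^{(i)})^{(i)} = ω` and `sgn (!b) = - sgn b`). -/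
theorem decide_deriv_flip (q : (κ → Bool) → ℝ) (i : κ) (ω : κ → Bool) :
    decide (0 ≤ sgn (Function.update ω i (!ω i) i) *
        (q (Function.update ω i (!ω i)) -
          q (Function.update (Function.update ω i (!ω i)) i
            (!(Function.update ω i (!ω i) i))))) =
      decide (0 ≤ sgn (ω i) * (q ω - q (Function.update ω i (!ω i)))) := by
  have hsn : sgn (!ω i) = -sgn (ω i) := by cases ω i <;> simp [sgn]
  rw [update_not_update_not ω i, Function.update_self, hsn]
  rw [show -sgn (ω i) * (q (Function.update ω i (!ω i)) - q ω) =
      sgn (ω i) * (q ω - q (Function.update ω i (!ω i))) by ring]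

variable [Fintype κ]

/-- Reindexing a sum over the cube by the bit flip at `i` (an involution of the cube). -/
theorem sum_flip (i : κ) (f : (κ → Bool) → ℝ) :
    ∑ ω : κ → Bool, f (Function.update ω i (!ω i)) = ∑ ω : κ → Bool, f ω := by
  have hinv : Function.Involutive (fun ω : κ → Bool => Function.update ω i (!ω i)) :=
    fun ω => update_not_update_not ω i
  exact hinv.bijective.sum_comp f

/-- **The DRST recursion, abstract form.** Let `f` be a Boolean function on the cube `κ → Bool`
and `g_i` (`i : κ`) Boolean functions, `g_i` independent of bit `i`, tied to `f` by the pointwise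
pivotal identity `[f ω ≠ f ω^{(i)}] = ½ sgn (g_i ω) sgn (ω i) (sgn (f ω) − sgn (f ω^{(i)}))`. Then
`(Σ_ω #{i : f ω ≠ f ω^{(i)}})² ≤ 2^{|κ|} (|κ| 2^{|κ|} + Σ_j Σ_ω #{i : g_j ω ≠ g_j ω^{(i)}})`. -/
theorem sq_sum_card_pivotal_le (f : (κ → Bool) → Bool) (g : κ → (κ → Bool) → Bool)
    (hg : ∀ i ω, g i (Function.update ω i (!ω i)) = g i ω)
    (hpiv : ∀ i ω, (if f ω ≠ f (Function.update ω i (!ω i)) then (1 : ℝ) else 0) =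
      1 / 2 * sgn (g i ω) * sgn (ω i) * (sgn (f ω) - sgn (f (Function.update ω i (!ω i))))) :
    (∑ ω : κ → Bool, ((univ.filter fun i : κ =>
        f ω ≠ f (Function.update ω i (!ω i))).card : ℝ)) ^ 2
      ≤ (2 : ℝ) ^ Fintype.card κ * ((Fintype.card κ : ℝ) * (2 : ℝ) ^ Fintype.card κ +
          ∑ j : κ, ∑ ω : κ → Bool, ((univ.filter fun i : κ =>
            g j ω ≠ g j (Function.update ω i (!ω i))).card : ℝ)) := by
  have sgn_not : ∀ b : Bool, sgn (!b) = -sgn b := fun b => by cases b <;> simp [sgn]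
  set N : ℝ := (2 : ℝ) ^ Fintype.card κ
  have hcard : ((univ : Finset (κ → Bool)).card : ℝ) = N := by
    rw [card_univ, Fintype.card_fun, Fintype.card_bool]; push_cast; rfl
  -- the summands `a_i = G_i X_i` of `H = Σ_i a_i`
  set a : κ → (κ → Bool) → ℝ := fun i ω => sgn (g i ω) * sgn (ω i) with ha
  -- Step 1: column by column, the pivotal count is the correlation `Σ_ω sgn (f ω) · a_i ω`
  have hcol : ∀ i : κ,
      ∑ ω : κ → Bool, (if f ω ≠ f (Function.update ω i (!ω i)) then (1 : ℝ) else 0) =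
        ∑ ω : κ → Bool, sgn (f ω) * a i ω := by
    intro i
    have hre : ∑ ω : κ → Bool, sgn (g i ω) * sgn (ω i) * sgn (f (Function.update ω i (!ω i))) =
        -∑ ω : κ → Bool, sgn (g i ω) * sgn (ω i) * sgn (f ω) := by
      rw [← sum_flip i (fun ω => sgn (g i ω) * sgn (ω i) * sgn (f (Function.update ω i (!ω i)))),
        ← sum_neg_distrib]
      refine sum_congr rfl fun ω _ => ?_
      simp only [hg, Function.update_self, sgn_not, Bool.not_not, Function.update_idem,
        Function.update_eq_self]
      ring
    have hrhs : ∑ ω : κ → Bool, sgn (f ω) * a i ω =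
        ∑ ω : κ → Bool, sgn (g i ω) * sgn (ω i) * sgn (f ω) :=
      sum_congr rfl fun ω _ => by simp only [ha]; ring
    calc ∑ ω : κ → Bool, (if f ω ≠ f (Function.update ω i (!ω i)) then (1 : ℝ) else 0)
        = ∑ ω : κ → Bool, 1 / 2 * sgn (g i ω) * sgn (ω i) *
            (sgn (f ω) - sgn (f (Function.update ω i (!ω i)))) :=
          sum_congr rfl fun ω _ => hpiv i ω
      _ = 1 / 2 * ∑ ω : κ → Bool, sgn (g i ω) * sgn (ω i) * sgn (f ω) -
            1 / 2 * ∑ ω : κ → Bool,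
              sgn (g i ω) * sgn (ω i) * sgn (f (Function.update ω i (!ω i))) := by
          rw [mul_sum, mul_sum, ← sum_sub_distrib]
          exact sum_congr rfl fun ω _ => by ring
      _ = ∑ ω : κ → Bool, sgn (f ω) * a i ω := by
          rw [hre, hrhs]; ring
  have h1 : ∑ ω : κ → Bool, ((univ.filter fun i : κ =>
        f ω ≠ f (Function.update ω i (!ω i))).card : ℝ) =
      ∑ ω : κ → Bool, sgn (f ω) * ∑ i, a i ω := by
    calc ∑ ω : κ → Bool, ((univ.filter fun i : κ =>
          f ω ≠ f (Function.update ω i (!ω i))).card : ℝ)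
        = ∑ ω : κ → Bool, ∑ i : κ,
            (if f ω ≠ f (Function.update ω i (!ω i)) then (1 : ℝ) else 0) :=
          sum_congr rfl fun ω _ => natCast_card_filter _ _
      _ = ∑ i : κ, ∑ ω : κ → Bool,
            (if f ω ≠ f (Function.update ω i (!ω i)) then (1 : ℝ) else 0) := sum_comm
      _ = ∑ i : κ, ∑ ω : κ → Bool, sgn (f ω) * a i ω := sum_congr rfl fun i _ => hcol i
      _ = ∑ ω : κ → Bool, ∑ i : κ, sgn (f ω) * a i ω := sum_comm
      _ = ∑ ω : κ → Bool, sgn (f ω) * ∑ i, a i ω := sum_congr rfl fun ω _ => by rw [mul_sum]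
  -- Step 2: Cauchy–Schwarz
  have h2 : (∑ ω : κ → Bool, sgn (f ω) * ∑ i, a i ω) ^ 2 ≤
      N * ∑ ω : κ → Bool, (∑ i, a i ω) ^ 2 := by
    have hCS := sum_mul_sq_le_sq_mul_sq (univ : Finset (κ → Bool)) (fun ω => sgn (f ω))
      (fun ω => ∑ i, a i ω)
    have hF : ∑ ω : κ → Bool, sgn (f ω) ^ 2 = N := by
      simp only [sq, sgn_mul_self, sum_const, nsmul_eq_mul, mul_one, hcard]
    simpa only [hF] using hCS
  -- Step 3: near-orthogonality of the `a_i`: the Gram matrix entrywise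
  have hpair : ∀ i j : κ, ∑ ω : κ → Bool, a i ω * a j ω ≤
      (if i = j then N else 0) +
        ∑ ω : κ → Bool, (if g j ω ≠ g j (Function.update ω i (!ω i)) then (1 : ℝ) else 0) := by
    intro i j
    have hind : 0 ≤ ∑ ω : κ → Bool,
        (if g j ω ≠ g j (Function.update ω i (!ω i)) then (1 : ℝ) else 0) :=
      sum_nonneg fun ω _ => by split_ifs <;> norm_num
    by_cases hij : i = j
    · subst hij
      have hsq : ∀ ω : κ → Bool, a i ω * a i ω = 1 := fun ω => by
        simp only [ha]
        cases g i ω <;> cases ω i <;> norm_num [sgn]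
      rw [if_pos rfl, sum_congr rfl fun ω _ => hsq ω, sum_const, nsmul_eq_mul, mul_one, hcard]
      linarith
    · rw [if_neg hij, zero_add]
      -- symmetrise under the flip of bit `i`
      have h2T : 2 * ∑ ω : κ → Bool, a i ω * a j ω =
          ∑ ω : κ → Bool, (a i ω * a j ω +
            a i (Function.update ω i (!ω i)) * a j (Function.update ω i (!ω i))) := by
        rw [sum_add_distrib, sum_flip i (fun ω => a i ω * a j ω)]
        ring
      have hpt : ∀ ω : κ → Bool, a i ω * a j ω +
          a i (Function.update ω i (!ω i)) * a j (Function.update ω i (!ω i)) ≤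
            2 * (if g j ω ≠ g j (Function.update ω i (!ω i)) then (1 : ℝ) else 0) := by
        intro ω
        have hj : Function.update ω i (!ω i) j = ω j := Function.update_of_ne (Ne.symm hij) _ _
        calc a i ω * a j ω + a i (Function.update ω i (!ω i)) * a j (Function.update ω i (!ω i))
            = sgn (g i ω) * sgn (ω i) * sgn (ω j) *
                (sgn (g j ω) - sgn (g j (Function.update ω i (!ω i)))) := by
              simp only [ha, hg, hj, Function.update_self, sgn_not]
              ring
          _ ≤ _ := sgn_mul_sub_le _ _ _ _ _
      have hsum : ∑ ω : κ → Bool, (a i ω * a j ω +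
          a i (Function.update ω i (!ω i)) * a j (Function.update ω i (!ω i))) ≤
          ∑ ω : κ → Bool,
            2 * (if g j ω ≠ g j (Function.update ω i (!ω i)) then (1 : ℝ) else 0) :=
        sum_le_sum fun ω _ => hpt ω
      rw [← h2T, ← mul_sum] at hsum
      linarith
  have h3 : ∑ ω : κ → Bool, (∑ i, a i ω) ^ 2 ≤
      (Fintype.card κ : ℝ) * N + ∑ j : κ, ∑ ω : κ → Bool, ((univ.filter fun i : κ =>
        g j ω ≠ g j (Function.update ω i (!ω i))).card : ℝ) := by
    calc ∑ ω : κ → Bool, (∑ i, a i ω) ^ 2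
        = ∑ ω : κ → Bool, ∑ i : κ, ∑ j : κ, a i ω * a j ω :=
          sum_congr rfl fun ω _ => by rw [sq, sum_mul_sum]
      _ = ∑ i : κ, ∑ ω : κ → Bool, ∑ j : κ, a i ω * a j ω := sum_comm
      _ = ∑ i : κ, ∑ j : κ, ∑ ω : κ → Bool, a i ω * a j ω :=
          sum_congr rfl fun i _ => sum_comm
      _ ≤ ∑ i : κ, ∑ j : κ, ((if i = j then N else 0) +
            ∑ ω : κ → Bool,
              (if g j ω ≠ g j (Function.update ω i (!ω i)) then (1 : ℝ) else 0)) :=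
          sum_le_sum fun i _ => sum_le_sum fun j _ => hpair i j
      _ = (Fintype.card κ : ℝ) * N + ∑ i : κ, ∑ j : κ, ∑ ω : κ → Bool,
            (if g j ω ≠ g j (Function.update ω i (!ω i)) then (1 : ℝ) else 0) := by
          simp only [sum_add_distrib, sum_ite_eq, mem_univ, if_true, sum_const, card_univ,
            nsmul_eq_mul]
      _ = (Fintype.card κ : ℝ) * N + ∑ j : κ, ∑ i : κ, ∑ ω : κ → Bool,
            (if g j ω ≠ g j (Function.update ω i (!ω i)) then (1 : ℝ) else 0) := by
          congr 1
          exact sum_comm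
      _ = (Fintype.card κ : ℝ) * N + ∑ j : κ, ∑ ω : κ → Bool, ∑ i : κ,
            (if g j ω ≠ g j (Function.update ω i (!ω i)) then (1 : ℝ) else 0) := by
          congr 1
          exact sum_congr rfl fun j _ => sum_comm
      _ = (Fintype.card κ : ℝ) * N + ∑ j : κ, ∑ ω : κ → Bool, ((univ.filter fun i : κ =>
            g j ω ≠ g j (Function.update ω i (!ω i))).card : ℝ) := by
          congr 1
          exact sum_congr rfl fun j _ => sum_congr rfl fun ω _ => (natCast_card_filter _ _).symm
  -- combine
  rw [h1]
  exact h2.trans (mul_le_mul_of_nonneg_left h3 (by positivity))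

end StubDrstRecursion

/-- **The DRST recursion for real functions on the cube** (stub `stub_drstRecursion` of skeleton
v10, the PTF rung). For every `q : {0,1}^m → ℝ`:
`piv(q)² ≤ 2^m (m 2^m + Σ_j piv(D_j q))`, where `piv(q) = Σ_ω #{i : [0 ≤ q ω] ≠ [0 ≤ q ω^{(i)}]}`
counts the pairs (point, pivotal bit) of the threshold function `[q ≥ 0]` and
`D_j q (ω) = sgn (ω j) (q ω − q ω^{(j)})` is the discrete derivative (Diakonikolas–Raghavendra–
Servedio–Tan 2009, §6; here for an arbitrary `q`, with no degree hypothesis). -/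
theorem stub_drstRecursion (m : ℕ) (q : (Fin m → Bool) → ℝ) :
    (∑ ω : Fin m → Bool, ((Finset.univ.filter fun i : Fin m =>
        decide (0 ≤ q ω) ≠ decide (0 ≤ q (Function.update ω i (!ω i)))).card : ℝ)) ^ 2
      ≤ (2 : ℝ) ^ m * ((m : ℝ) * (2 : ℝ) ^ m +
          ∑ j : Fin m, ∑ ω : Fin m → Bool, ((Finset.univ.filter fun i : Fin m =>
            decide (0 ≤ sgn (ω j) * (q ω - q (Function.update ω j (!ω j)))) ≠
            decide (0 ≤ sgn (Function.update ω i (!ω i) j) *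
              (q (Function.update ω i (!ω i)) -
                q (Function.update (Function.update ω i (!ω i)) j
                  (!(Function.update ω i (!ω i) j)))))).card : ℝ)) := by
  have h := StubDrstRecursion.sq_sum_card_pivotal_le (κ := Fin m) (fun ω => decide (0 ≤ q ω))
    (fun i ω => decide (0 ≤ sgn (ω i) * (q ω - q (Function.update ω i (!ω i)))))
    (fun i ω => StubDrstRecursion.decide_deriv_flip q i ω)
    (fun i ω => StubDrstRecursion.ite_ne_eq_half_mul (q ω) (q (Function.update ω i (!ω i))) (ω i))
  simpa only [Fintype.card_fin] using h

end Summit.QuantumAdvantage.QuantumAdvantage.Theorems.LiouvilleOrthogonalTC0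

end
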